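import Literature.ModelTheory.ExponentialFields.ModelTheoryPreds
import Mathlib.ModelTheory.Arithmetic.Presburger.Basic
import Mathlib.Order.Filter.AtTopBot.Basic
import Mathlib.Algebra.Group.Int.Even
import HarnessLib

/-!
# O-minimality: non-vacuity of the predicate and a non-example

`FirstOrder.Language.IsOMinimal L M` (`Literature/ModelTheory/ExponentialFields/ModelTheoryPreds.lean`)
is the *definition* of an o-minimal structure — Pillay–Steinhorn, *Definable sets in ordered
structures I*, Trans. AMS 295 (1986), Def. 1.1 (p. 566); van den Dries, *Tame topology and
o-minimal structures* (1998), Ch. 1, (3.2) and (5.7) — i.e. a predicate on an `L`-structure `M`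
carrying a linear order, not a closed proposition. Its universal closure is false, and this file
records the standard witnesses, sorry-free:

* `Literature.ModelTheory.ExponentialFields.IsFiniteUnionOfIntervals.eventually_mem_or_eventually_notMem`: a finite union of points and
  intervals is *eventually constant* at `+∞` — it contains all sufficiently large elements or omits
  all sufficiently large elements. This is the invariant behind van den Dries 1998, Ch. 1, proof of
  (4.2) (a definable set cannot alternate in/out along an unbounded increasing sequence).
* `Literature.ModelTheory.ExponentialFields.not_isFiniteUnionOfIntervals_setOf_even_int`: the even integers `2ℤ ⊆ ℤ` are not a finite
  union of points and intervals.
* `FirstOrder.Language.isOMinimal_of_finite`: every structure on a finite linear order is o-minimal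
  (non-vacuity of the predicate; Pillay–Steinhorn 1986, Def. 1.1 allows arbitrary linear orders).
* `FirstOrder.Language.not_isOMinimal_presburger_int`: Presburger arithmetic `(ℤ; 0, 1, +)` with the
  usual order of `ℤ` is **not** o-minimal, because `2ℤ = {x | ∃ y, y + y = x}` is definable
  (van den Dries 1998, Ch. 1, (4.2): an o-minimal expansion of an ordered group is divisible, and
  `(ℤ, +)` is not).
* `FirstOrder.Language.not_forall_isOMinimal`: hence `IsOMinimal` is a genuine hypothesis (as in the
  named facts `Literature.ModelTheory.ExponentialFields.wilkie_isOMinimal`, `Literature.ModelTheory.ExponentialFields.real_isOMinimal` of `RealExpField.lean`), not a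
  dischargeable fact: there is no `IsOMinimal_holds`.

## References

* [Dries1998] L. van den Dries, *Tame topology and o-minimal structures*, LMS Lecture Note Series 248,
  CUP 1998, doi:10.1017/cbo9780511525919 — Ch. 1, (3.2), (4.2), (5.7).
* [PillaySteinhorn1986] A. Pillay, C. Steinhorn, *Definable sets in ordered structures I*,
  Trans. AMS 295 (1986) 565–592, doi:10.1090/s0002-9947-1986-0833697-x — Def. 1.1.
-/

open Set Filter
open scoped FirstOrder

namespace Literature.ModelTheory.ExponentialFields

namespace IsFiniteUnionOfIntervals

variable {M : Type*} [LinearOrder M] {s : Set M}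

/-- A finite union of points and intervals in a linear order is *eventually constant at* `+∞`:
either all sufficiently large elements belong to it, or all sufficiently large elements lie outside
it. (For the generators: `Set.Iio a` omits `[a, ∞)`; `Set.Ioi a` contains `(a, ∞)`, which is
cofinal unless `a` is maximal, in which case `Set.Ioi a = ∅`; the property is preserved by finite
unions and complements.) This is the invariant used in van den Dries 1998, Ch. 1, proof of (4.2):
membership in a finite union of intervals and points cannot alternate along an unbounded increasing
sequence. [cite: Dries1998, Ch. 1 (4.2), proof of the Lemma] -/
theorem eventually_mem_or_eventually_notMem (hs : IsFiniteUnionOfIntervals s) :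
    (∀ᶠ x in atTop, x ∈ s) ∨ (∀ᶠ x in atTop, x ∉ s) := by
  induction hs using BooleanSubalgebra.closure_bot_sup_induction with
  | mem s hs =>
    rcases hs with ⟨a, rfl⟩ | ⟨a, rfl⟩
    · exact Or.inr ((eventually_ge_atTop a).mono fun x hx => not_lt.2 hx)
    · by_cases ha : IsMax a
      · exact Or.inr (Eventually.of_forall fun x => ha.not_lt)
      · obtain ⟨b, hb⟩ := not_isMax_iff.1 ha
        exact Or.inl ((eventually_ge_atTop b).mono fun x hx => lt_of_lt_of_le hb hx)
  | bot => exact Or.inr (Eventually.of_forall fun x hx => hx)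
  | sup s _ t _ ihs iht =>
    rcases ihs with hs | hs
    · exact Or.inl (hs.mono fun x hx => Or.inl hx)
    · rcases iht with ht | ht
      · exact Or.inl (ht.mono fun x hx => Or.inr hx)
      · exact Or.inr ((hs.and ht).mono fun x hx h => h.elim hx.1 hx.2)
  | compl s _ ih =>
    rcases ih with h | h
    · exact Or.inr (h.mono fun x hx hxc => hxc hx)
    · exact Or.inl h

end IsFiniteUnionOfIntervals

/-- The set `2ℤ` of even integers is not a finite union of points and intervals of `(ℤ, <)`:
membership alternates along `a < a + 1 < a + 2 < ⋯` (van den Dries 1998, Ch. 1, proof of (4.2),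
applied to the proper non-trivial subgroup `2ℤ` of the ordered group `(ℤ, <, +)`).
[cite: Dries1998, Ch. 1 (4.2), proof] -/
theorem not_isFiniteUnionOfIntervals_setOf_even_int :
    ¬ IsFiniteUnionOfIntervals {n : ℤ | Even n} := by
  intro h
  rcases h.eventually_mem_or_eventually_notMem with h | h
  · obtain ⟨a, ha⟩ := eventually_atTop.1 h
    exact (Int.even_add_one.1 (ha (a + 1) (by omega))) (ha a le_rfl)
  · obtain ⟨a, ha⟩ := eventually_atTop.1 h
    exact (ha (a + 1) (by omega)) (Int.even_add_one.2 (ha a le_rfl))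

end Literature.ModelTheory.ExponentialFields

namespace FirstOrder

namespace Language

/-- Non-vacuity of the predicate `Language.IsOMinimal`: any structure (in any language) on a
*finite* linear order is o-minimal, since every subset is finite and finite sets are finite unions
of points (Pillay–Steinhorn 1986, Def. 1.1, which allows arbitrary linear orders; van den Dries
1998, Ch. 1, (3.2) restricts to dense orders without endpoints, where this case does not arise).
[folklore] -/
theorem isOMinimal_of_finite (L : Language) (M : Type*) [L.Structure M] [LinearOrder M]
    [Finite M] : L.IsOMinimal M :=
  fun s _ => Literature.ModelTheory.ExponentialFields.IsFiniteUnionOfIntervals.of_finite s.toFinite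

/-- In Presburger arithmetic `(ℤ; 0, 1, +)` (Mathlib's `Language.presburger` structure on `ℤ`) the
subgroup `2ℤ` of even integers is definable without parameters, by `∃ y, y + y = x`. [folklore] -/
theorem definable₁_setOf_even_int (A : Set ℤ) :
    A.Definable₁ Language.presburger {n : ℤ | Even n} := by
  refine (Set.Definable.mono ?_ (Set.empty_subset A))
  refine (Set.empty_definable_iff).2 ⟨∃' ((&0 + &0) =' Term.var (Sum.inl 0)), ?_⟩
  ext x
  simp only [Set.mem_setOf_eq, Formula.Realize, BoundedFormula.realize_ex,
    BoundedFormula.realize_bdEqual, Language.presburger.realize_add, Term.realize_var,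
    Function.comp_apply, Sum.elim_inr, Sum.elim_inl, Even]
  constructor
  · rintro ⟨r, hr⟩
    exact ⟨r, by simpa [Fin.snoc] using hr.symm⟩
  · rintro ⟨r, hr⟩
    exact ⟨r, by simpa [Fin.snoc] using hr.symm⟩

/-- **Presburger arithmetic on `ℤ` is not o-minimal.** For the structure `(ℤ; 0, 1, +)`
(`Language.presburger`) and the usual order of `ℤ`, the definable set `2ℤ = {x | ∃ y, y + y = x}`
is not a finite union of points and intervals. This is the standard non-example behind
van den Dries 1998, Ch. 1, (4.2) (an o-minimal expansion of an ordered group is divisible; `(ℤ, +)`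
is not) and Pillay–Steinhorn 1986, Thm. 2.1. [cite: Dries1998, Ch. 1 (4.2)] -/
theorem not_isOMinimal_presburger_int : ¬ Language.presburger.IsOMinimal ℤ := fun h =>
  Literature.ModelTheory.ExponentialFields.not_isFiniteUnionOfIntervals_setOf_even_int (h _ (definable₁_setOf_even_int Set.univ))

/-- `Language.IsOMinimal` is a *definition* (Pillay–Steinhorn 1986, Def. 1.1), not a theorem: its
universal closure fails, witnessed by Presburger arithmetic on `ℤ`
(`not_isOMinimal_presburger_int`). In particular there is no discharge `IsOMinimal_holds`;
o-minimality of a specific structure (`Literature.ModelTheory.ExponentialFields.real_isOMinimal`, `Literature.ModelTheory.ExponentialFields.wilkie_isOMinimal`) is a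
substantive theorem to be cited or proved case by case. [cite: Dries1998, Ch. 1 (4.2)] -/
theorem not_forall_isOMinimal :
    ¬ ∀ (L : Language.{0, 0}) (M : Type) [L.Structure M] [LinearOrder M], L.IsOMinimal M :=
  fun h => not_isOMinimal_presburger_int (h Language.presburger ℤ)

end Language

end FirstOrder
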